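import Mathlib.NumberTheory.Padics.RingHoms
import Mathlib.LinearAlgebra.Matrix.Charpoly.Coeff
import Literature.NumberTheory.FaltingsSerre.Criterion
import Literature.NumberTheory.GaloisRepresentations.GaloisRep
import Literature.NumberTheory.GaloisRepresentations.IntegralGaloisActionProofs
import Literature.NumberTheory.GaloisRepresentations.CarayolSerreLemmasProofs
import HarnessLib

/-!
# The Faltings–Serre method after Brumer–Pacetti–Poor–Tornaría–Voight–Yuen, III:
# the certificate schema and `paramodular_of_certificate`

[BPPTVY] = Brumer–Pacetti–Poor–Tornaría–Voight–Yuen, *On the paramodularity of typical abelian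
surfaces*, Algebra & Number Theory **13**:5 (2019) 1145–1195 [cite: BrumerEtAl2019] (PRINTED numbering and
pages throughout; the arXiv:1805.10873v4 text carries the same statements — see the "Numbering" note
in `Criterion.lean`).  This file types WHAT DATA PROVES `L_p(A,T) = Q_p(f,T)` (`p ∉ S`) in the method of
[BPPTVY, §§2, 4, 7], as a `Prop`-valued record `Certificate` whose fields are exactly the hypotheses
of the criterion `Criterion.traceEq_of_faltingsSerre_symplectic` specialised to
`Γ = Gal(K̄/K)`, `I` = the inertia groups outside `S`, `T` = the arithmetic Frobenius elements at a
finite set of places `P` — together with the kernel-checked implications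

* `Certificate.trace_eq`         : certificate ⟹ `tr ρ₁ = tr ρ₂` on all of `Gal(K̄/K)`;
* `Certificate.exists_conj`      : certificate ⟹ `ρ₂ = g ρ₁ g⁻¹` for some `g ∈ GL_n(ℤ_ℓ)` (via the
  tree's PROVED Carayol theorem, [BPPTVY, Thm. 2.1.4 p. 1150]);
* `Certificate.hasFrobCharpolyAt_iff` : ⟹ the two representations have the same Frobenius
  characteristic polynomials at every place;
* `paramodular_of_certificate`   : ⟹ `L_v(ρ₁) = L_v(ρ₂)` for every `v ∉ S`, where `L_v` are the
  PRESCRIBED Euler polynomials of the two sides (`EulerDatum`: [BPPTVY, (4.1.3)–(4.1.5) pp. 1163–1164]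
  for `A`, [BPPTVY, Thm. 4.3.4(iv) p. 1169] for `f`).

and the numerical schema `CertificateData` of the three published certificates
([BPPTVY, Thm. 7.1.3 `N = 277` p. 1187, Thm. 7.2.1 `N = 353` p. 1189, Thm. 7.3.1 `N = 587` p. 1191],
proofs pp. 1187–1192), recorded verbatim.

WHAT IS *NOT* CLAIMED (cell rules S3/A7; the cell's DIVERGENCE.md D-4/D-5): (i) "paramodular" is not
a tree notion — there is no type of Siegel paramodular forms `S_k(K(N))` in the tree (definition
requests filed); the `f`-side therefore enters as an `EulerDatum` for a framed representation
`ρ_{f,2}`, whose EXISTENCE with the listed properties is [BPPTVY, Thm. 4.3.4 p. 1169] (Taylor,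
Laumon, Weissauer, Schmidt, Mok; Mok 2014 Thm. 4.14 — the attachment of a global ARTHUR PARAMETER of
type (G) to `f` following Schmidt 2018, p. 1168, DEPENDS ON ARTHUR'S CLASSIFICATION for `GSp₄`;
cross-reference: cell `pub-arthur`) followed by the descent [BPPTVY, Lemma 4.3.8(b) p. 1171] to
`GSp₄(ℤ₂)`; (ii) the conclusion is Euler-factor equality at `v ∉ S` only: at `p = ℓ = 2` and `p ∣ N`
[BPPTVY, Thm. 7.1.3] needs in addition `ℓ`-independence / local Langlands up to semisimplification
([BPPTVY, Thm. 4.3.4(v) p. 1169, Lemma 4.3.10 p. 1172]), which the `2`-adic trace identity does not give.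

## References

* [BPPTVY] A. Brumer, A. Pacetti, C. Poor, G. Tornaría, J. Voight, D. S. Yuen, Algebra & Number
  Theory 13:5 (2019) 1145–1195, doi:10.2140/ant.2019.13.1145: §2 (Thm. 2.1.4, Thm. 2.1.5 p. 1150,
  Alg. 2.2.3 p. 1151, Alg. 2.4.1 p. 1156), §4.1 (4.1.3)–(4.1.5) pp. 1163–1164, (4.2.18) p. 1168,
  §4.3 Thm. 4.3.4 p. 1169 and Lemma 4.3.8 p. 1171, Lemma 4.3.10 p. 1172, §5.1 (5.1.1)–(5.1.2) and
  Lemma 5.1.7 p. 1173, §5.2 Lemma 5.2.1 p. 1174, §5.3 Thm. 5.3.1/5.3.3 p. 1176, §7 Thm. 7.1.3 and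
  Lemma 7.1.4 p. 1187, Thm. 7.2.1 p. 1189, (7.2.3)–(7.2.4) p. 1190, Thm. 7.3.1 and (7.3.2) p. 1191,
  (7.3.3) p. 1192.  [cite: BrumerEtAl2019]
* H. Carayol, Contemp. Math. 165 (1994), Thm. 1 — tree:
  `Literature.NumberTheory.GaloisRepresentations.exists_conj_eq_of_trace_eq_of_isAbsIrreducible_residual_holds`.
-/

noncomputable section

namespace Literature.NumberTheory.FaltingsSerre

open Matrix Polynomial Field IsDedekindDomain
open Literature.NumberTheory.GaloisRepresentations
open scoped NumberField

/-! ### A. From `ZMod ℓ` to Mathlib's residue field (bridge to the tree's Carayol theorem) -/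

section Bridge

variable {ℓ : ℕ} [Fact ℓ.Prime] {G : Type*} [Group G] {n : ℕ}

/-- Absolute irreducibility of `ρ̄ = ρ mod ℓ` typed with `ZMod ℓ` (`Criterion.residual`) implies
absolute irreducibility of `ρ mod 𝔪` typed with Mathlib's `IsLocalRing.ResidueField ℤ_[ℓ]` (the
form consumed by the tree's Carayol theorem), via `PadicInt.residueField : 𝓀(ℤ_[ℓ]) ≃+* ZMod ℓ` and
`PadicInt.toZMod_eq_residueField_comp_residue`. [folklore] -/
theorem isAbsIrreducible_residue_of_residual (ρ : G →* GL (Fin n) ℤ_[ℓ])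
    (h : IsAbsIrreducible (residual ρ)) :
    IsAbsIrreducible ((Matrix.GeneralLinearGroup.map (IsLocalRing.residue ℤ_[ℓ])).comp ρ) := by
  intro k' _ f
  let f' : ZMod ℓ →+* k' := f.comp (PadicInt.residueField (p := ℓ)).symm.toRingHom
  have key : (Matrix.GeneralLinearGroup.map f').comp (residual ρ) =
      (Matrix.GeneralLinearGroup.map f).comp
        ((Matrix.GeneralLinearGroup.map (IsLocalRing.residue ℤ_[ℓ])).comp ρ) := by
    refine MonoidHom.ext fun σ => Units.ext (Matrix.ext fun i j => ?_)
    -- `PadicInt.toZMod = residueField ∘ residue` definitionally (`PadicInt.toZMod_eq_residueField_comp_residue`)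
    change f ((PadicInt.residueField (p := ℓ)).symm (PadicInt.residueField (p := ℓ)
        (IsLocalRing.residue ℤ_[ℓ] (((ρ σ : GL (Fin n) ℤ_[ℓ]) : Matrix (Fin n) (Fin n) ℤ_[ℓ]) i j)))) =
      f (IsLocalRing.residue ℤ_[ℓ] (((ρ σ : GL (Fin n) ℤ_[ℓ]) : Matrix (Fin n) (Fin n) ℤ_[ℓ]) i j))
    rw [RingEquiv.symm_apply_apply]
  have := h k' f'
  rwa [key] at this

end Bridge

/-! ### B. Galois-theoretic sets: inertia outside `S`, Frobenius elements at `P` -/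

section Sets

variable (K : Type) [Field K]

/-- The union of the inertia subgroups `I(𝔓 | v) ≤ Gal(K̄/K)` over all finite places `v ∉ S` and
all primes `𝔓` of `K̄` above `v` ("`Gal_{F,S}`": a representation factors through `Gal_{F,S}` iff it
is trivial on this set). [cite: BrumerEtAl2019, §2.1 p. 1150] -/
def inertiaOutside (S : Set (HeightOneSpectrum (𝓞 K))) : Set (absoluteGaloisGroup K) :=
  {σ | ∃ v, v ∉ S ∧ ∃ 𝔓 ∈ v.primesAbove, σ ∈ 𝔓.inertia (absoluteGaloisGroup K)}

/-- The set of arithmetic Frobenius elements `Frob_𝔓 ∈ Gal(K̄/K)`, `𝔓 | v`, `v ∈ P` ("the primes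
found in Step 4" of [BPPTVY, Algorithm 2.4.1]). [cite: BrumerEtAl2019, Algorithm 2.4.1 Step 4 p. 1156] -/
def frobeniusAt (P : Set (HeightOneSpectrum (𝓞 K))) : Set (absoluteGaloisGroup K) :=
  {σ | ∃ v ∈ P, ∃ 𝔓 ∈ v.primesAbove, IsArithFrobAt (𝓞 K) σ 𝔓}

variable {K}

/-- A framed Galois representation unramified outside `S` is trivial on `inertiaOutside K S`
(unfolding of `FramedGaloisRep.IsUnramifiedAt`). [folklore] -/
theorem apply_eq_one_of_mem_inertiaOutside {A : Type*} [CommRing A] [TopologicalSpace A] {n : ℕ}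
    {S : Set (HeightOneSpectrum (𝓞 K))} {ρ : FramedGaloisRep K A n}
    (h : ∀ v ∉ S, ρ.IsUnramifiedAt v) {σ : absoluteGaloisGroup K} (hσ : σ ∈ inertiaOutside K S) :
    ρ σ = 1 := by
  obtain ⟨v, hv, 𝔓, h𝔓, hσ𝔓⟩ := hσ
  exact h v hv 𝔓 h𝔓 σ hσ𝔓

end Sets

/-! ### C. The certificate (a `Prop`-valued record = the hypotheses of the criterion) -/

section Certificate

variable {K : Type} [Field K] {ℓ : ℕ} [Fact ℓ.Prime] {n : ℕ}

/-- **Certificate schema: what data proves `ρ₁ ≃ ρ₂` (hence `L(A,s) = L(f,s)` away from `S`) in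
the method of [BPPTVY].**  For a number field `K`, a prime `ℓ`, finite sets of finite places
`S` ("bad": `ℓ` and the ramified places) and `P` ("the primes to check"), an alternating Gram
matrix `J` and a multiplier `ν : Gal(K̄/K) → ℤ_ℓ`, and two framed representations
`ρ₁ ρ₂ : Gal(K̄/K) → GL_n(ℤ_ℓ)`, a certificate consists of PROOFS of:
* `det_isUnit`, `transpose_eq`, `diag_eq` — `J` is a perfect alternating pairing
  ([BPPTVY, §4.1 p. 1163]: polarization of degree coprime to `ℓ`; (5.1.2) p. 1173: "`J ∈ M₄(𝔽₂)` is
  the antiidentity matrix");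
* `similitude₁`, `similitude₂` — both `ρᵢ` are similitudes of `J` with the same multiplier `ν`
  ([BPPTVY, (4.1.3) p. 1163]: "with determinant `χ_ℓ²` and similitude character `χ_ℓ`"; Thm. 4.3.4(ii)
  p. 1169 with `k = 2`; §7.1 p. 1187: "such that `det ρ_A = det ρ_f = χ₂²`");
* `residual_eq` — Step 1 (Algorithm 2.2.3 p. 1151 / [BPPTVY, Lemma 7.1.4 p. 1187]): the residual
  representations are EQUAL (after conjugating `ρ₂`; "We can assume as before that
  `ρ₁ ≡ ρ₂ (mod ℓ^r)`", p. 1157);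
* `absIrreducible` — `ρ̄` is absolutely irreducible ([BPPTVY, Lemma 5.2.1 p. 1174]: image `S₅(b)`,
  `S₆` or `S₃ ≀ S₂` in `GSp₄(𝔽₂) ≅ S₆`);
* `unramified₁`, `unramified₂` — both unramified outside `S` ((4.1.3) p. 1163; Thm. 4.3.4(iii) p. 1169);
* `complete` — Steps 2–4 with the `𝔰𝔭`-refinement (Lemma 2.3.20 / Remark 2.4.2 p. 1156 / (5.1.2)
  p. 1173, [BPPTVY, Thms. 5.3.1 and 5.3.3 p. 1176 and §6]): every locally constant deviation cocycle of `ρ̄` vanishing on the inertia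
  outside `S`, valued in `𝔰𝔭(J̄)(𝔽_ℓ)`, and obstructing, has an obstructing arithmetic Frobenius
  at some place of `P`;
* `traces` — Step 5: `tr ρ₁(Frob_𝔓) = tr ρ₂(Frob_𝔓)` for all Frobenius elements at places of `P`
  ([BPPTVY, §7.1]: "we will show that `tr ρ_A(Frob_p) = tr ρ_f(Frob_p)` for all `p ≤ 43`").
[cite: BrumerEtAl2019, Thm. 2.1.5 p. 1150, Algorithm 2.4.1 and Remark 2.4.2 p. 1156; (4.1.3) p. 1163; Thm. 4.3.4 p. 1169; Lemma 5.2.1 p. 1174; §7.1 pp. 1187–1188] -/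
structure Certificate (S P : Set (HeightOneSpectrum (𝓞 K))) (J : Matrix (Fin n) (Fin n) ℤ_[ℓ])
    (ν : absoluteGaloisGroup K → ℤ_[ℓ]) (ρ₁ ρ₂ : FramedGaloisRep K ℤ_[ℓ] n) : Prop where
  /-- `det J ∈ ℤ_ℓˣ`. -/
  det_isUnit : IsUnit J.det
  /-- `Jᵀ = -J`. -/
  transpose_eq : Jᵀ = -J
  /-- `J_{ii} = 0` (alternating, also in characteristic `2`). -/
  diag_eq : ∀ i, J i i = 0
  /-- `ρ₁(σ)ᵀ J ρ₁(σ) = ν(σ) J`. -/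
  similitude₁ : ∀ σ, IsSimilitude J (ν σ) ((ρ₁ σ : GL (Fin n) ℤ_[ℓ]) : Matrix (Fin n) (Fin n) ℤ_[ℓ])
  /-- `ρ₂(σ)ᵀ J ρ₂(σ) = ν(σ) J` (same `ν`). -/
  similitude₂ : ∀ σ, IsSimilitude J (ν σ) ((ρ₂ σ : GL (Fin n) ℤ_[ℓ]) : Matrix (Fin n) (Fin n) ℤ_[ℓ])
  /-- Step 1: `ρ̄₁ = ρ̄₂`. -/
  residual_eq : residual ρ₁.toMonoidHom = residual ρ₂.toMonoidHom
  /-- `ρ̄₁` is absolutely irreducible. -/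
  absIrreducible : IsAbsIrreducible (residual ρ₁.toMonoidHom)
  /-- `ρ₁` is unramified outside `S`. -/
  unramified₁ : ∀ v ∉ S, ρ₁.IsUnramifiedAt v
  /-- `ρ₂` is unramified outside `S`. -/
  unramified₂ : ∀ v ∉ S, ρ₂.IsUnramifiedAt v
  /-- Steps 2–4: the places of `P` detect every admissible obstructing cocycle. -/
  complete : ∀ μ : absoluteGaloisGroup K → Matrix (Fin n) (Fin n) (ZMod ℓ), IsLocallyConstant μ →
    (∀ σ ∈ inertiaOutside K S, μ σ = 0) → ValuedIn (spLie (J.map (PadicInt.toZMod (p := ℓ)))) μ →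
    IsDeviationCocycle (residual ρ₁.toMonoidHom) μ → IsObstructing (residual ρ₁.toMonoidHom) μ →
    ∃ σ ∈ frobeniusAt K P, IsObstructingElt (residual ρ₁.toMonoidHom) μ σ
  /-- Step 5: traces agree at the Frobenius elements of `P`. -/
  traces : ∀ σ ∈ frobeniusAt K P, FramedRep.trace ρ₁ σ = FramedRep.trace ρ₂ σ

variable {S P : Set (HeightOneSpectrum (𝓞 K))} {J : Matrix (Fin n) (Fin n) ℤ_[ℓ]}
  {ν : absoluteGaloisGroup K → ℤ_[ℓ]} {ρ₁ ρ₂ : FramedGaloisRep K ℤ_[ℓ] n}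

/-- **Certificate ⟹ equal traces everywhere** (the output "true" of [BPPTVY, Algorithm 2.4.1]),
from the cited criterion `traceEq_of_faltingsSerre_symplectic` with `Γ = Gal(K̄/K)`,
`I = inertiaOutside K S`, `T = frobeniusAt K P`. [cite: BrumerEtAl2019, Thm. 2.1.5 p. 1150 and Algorithm 2.4.1 pp. 1156–1157] -/
theorem Certificate.trace_eq (hFS : traceEq_of_faltingsSerre_symplectic)
    (C : Certificate S P J ν ρ₁ ρ₂) (σ : absoluteGaloisGroup K) :
    FramedRep.trace ρ₁ σ = FramedRep.trace ρ₂ σ :=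
  hFS ℓ (absoluteGaloisGroup K) n ρ₁.toMonoidHom ρ₂.toMonoidHom (map_continuous ρ₁) (map_continuous ρ₂)
    (inertiaOutside K S) (frobeniusAt K P) J C.det_isUnit C.transpose_eq C.diag_eq ν C.similitude₁
    C.similitude₂ C.residual_eq C.absIrreducible
    (fun _ hτ => ⟨apply_eq_one_of_mem_inertiaOutside C.unramified₁ hτ,
      apply_eq_one_of_mem_inertiaOutside C.unramified₂ hτ⟩)
    C.complete C.traces σ

/-- **Certificate ⟹ `ρ₁ ≃ ρ₂`**: `ρ₂ = g ρ₁ g⁻¹` for some `g ∈ GL_n(ℤ_ℓ)`, by `Certificate.trace_eq`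
and Carayol's theorem [BPPTVY, Thm. 2.1.4] = the tree's PROVED
`exists_conj_eq_of_trace_eq_of_isAbsIrreducible_residual_holds` over `A = ℤ_ℓ`.
[cite: BrumerEtAl2019, Thm. 2.1.4 and Thm. 2.1.5 p. 1150; Def. 2.1.1] -/
theorem Certificate.exists_conj (hFS : traceEq_of_faltingsSerre_symplectic)
    (C : Certificate S P J ν ρ₁ ρ₂) :
    ∃ g : GL (Fin n) ℤ_[ℓ], ∀ σ, ρ₂ σ = g * ρ₁ σ * g⁻¹ :=
  exists_conj_eq_of_trace_eq_of_isAbsIrreducible_residual_holds ℤ_[ℓ] (absoluteGaloisGroup K) n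
    ρ₁.toMonoidHom ρ₂.toMonoidHom (isAbsIrreducible_residue_of_residual _ C.absIrreducible)
    (fun σ => (C.trace_eq hFS σ).symm)

/-- **Certificate ⟹ equal Frobenius characteristic polynomials at EVERY place** (conjugate
matrices have the same characteristic polynomial, Mathlib `Matrix.charpoly_units_conj`).
[cite: BrumerEtAl2019, Thm. 7.1.3 p. 1187] -/
theorem Certificate.hasFrobCharpolyAt_iff (hFS : traceEq_of_faltingsSerre_symplectic)
    (C : Certificate S P J ν ρ₁ ρ₂) (v : HeightOneSpectrum (𝓞 K)) (Q : Polynomial ℤ_[ℓ]) :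
    ρ₁.HasFrobCharpolyAt v Q ↔ ρ₂.HasFrobCharpolyAt v Q := by
  obtain ⟨g, hg⟩ := C.exists_conj hFS
  have hc : ∀ σ, FramedRep.charpoly ρ₂ σ = FramedRep.charpoly ρ₁ σ := fun σ => by
    simp only [FramedRep.charpoly]
    rw [show ρ₂ σ = g * ρ₁ σ * g⁻¹ from hg σ, Units.val_mul, Units.val_mul, Matrix.coe_units_inv,
      Matrix.charpoly_units_conj]
  refine ⟨fun h 𝔓 h𝔓 σ hσ => ?_, fun h 𝔓 h𝔓 σ hσ => ?_⟩
  · rw [hc]; exact h 𝔓 h𝔓 σ hσ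
  · rw [← hc]; exact h 𝔓 h𝔓 σ hσ

/-- Conversely and trivially, the certificate's `traces` field is NECESSARY: conjugate
representations have equal traces at the Frobenius elements of any `P`. [folklore] -/
theorem traces_of_conj {g : GL (Fin n) ℤ_[ℓ]} (hg : ∀ σ, ρ₂ σ = g * ρ₁ σ * g⁻¹)
    (σ : absoluteGaloisGroup K) : FramedRep.trace ρ₁ σ = FramedRep.trace ρ₂ σ :=
  trace_eq_of_conj (ρ₁ := ρ₁.toMonoidHom) (ρ₂ := ρ₂.toMonoidHom) (P := g) hg σ

end Certificate

/-! ### D. The two sides as the method consumes them, and `paramodular_of_certificate` -/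

section Sides

variable {K : Type} [Field K] [NumberField K] {ℓ : ℕ} [Fact ℓ.Prime] {n : ℕ}

/-- **An Euler datum for a framed `ℤ_ℓ`-representation outside `S`**: prescribed polynomials
`E v ∈ ℤ_ℓ[X]` with `det(X − ρ(Frob_v)) = E v` for every `v ∉ S` (and unramifiedness there, so that
this is meaningful).  For `ρ = ρ_{A,ℓ}` this is [BPPTVY, (4.1.5) p. 1164]: "when `p ∤ ℓN`, we have
`det(1 − ρ_{A,ℓ}(Frob_p)T) = L_p(A,T) = 1 − a_pT + b_{p²}T² − pa_pT³ + p²T⁴ ∈ 1 + Tℤ[T]`", i.e.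
`E v = X⁴ − a_p X³ + b X² − p a_p X + p²` (`eulerPolynomialOfSurface`); for `ρ = ρ_{f,ℓ}` it is
[BPPTVY, Thm. 4.3.4(iv) p. 1169]: "`det(1 − ρ_{f,ℓ}(Frob_p)T) = Q_p(f,T)` for all `p ∤ ℓN`" with
`Q_p(f,T)` as in (4.2.18) p. 1168, i.e. `E v = heckePolynomial` below.
[cite: BrumerEtAl2019, (4.1.3)–(4.1.5) pp. 1163–1164 and Thm. 4.3.4(iii)–(iv) p. 1169] -/
structure EulerDatum (S : Set (HeightOneSpectrum (𝓞 K))) (ρ : FramedGaloisRep K ℤ_[ℓ] n) where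
  /-- The prescribed characteristic polynomial of Frobenius at `v` (junk allowed at `v ∈ S`). -/
  E : HeightOneSpectrum (𝓞 K) → Polynomial ℤ_[ℓ]
  /-- `ρ` is unramified at every `v ∉ S`. -/
  unramified : ∀ v ∉ S, ρ.IsUnramifiedAt v
  /-- `det(X − ρ(Frob_𝔓)) = E v` for every `𝔓 | v`, `v ∉ S`. -/
  hasFrobCharpoly : ∀ v ∉ S, ρ.HasFrobCharpolyAt v (E v)

/-- `X⁴ − a X³ + b X² − q a X + q²`: the reciprocal form of the Euler factor
`L_p(A,T) = 1 − a_pT + b_{p²}T² − pa_pT³ + p²T⁴` of an abelian surface at a good prime with `q = p`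
(`T⁴ L_p(A, 1/T)`). [cite: BrumerEtAl2019, (4.1.5) p. 1164] -/
def eulerPolynomialOfSurface {R : Type*} [CommRing R] (q : ℕ) (a b : ℤ) : Polynomial R :=
  X ^ 4 - C (a : R) * X ^ 3 + C (b : R) * X ^ 2 - C ((q : R) * a) * X + C ((q : R) ^ 2)

/-- `X⁴ − a X³ + b X² − q^{2k−3} a X + q^{4k−6}`: the reciprocal form of the Hecke polynomial
`Q_p(f,T) := 1 − a_p(f)T + b_{p²}(f)T² − p^{2k−3}a_p(f)T³ + p^{4k−6}T⁴` ("the spinor Euler factor at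
`p ∤ N` in the arithmetic normalization", [BPPTVY, (4.2.18) p. 1168], with
`b_{p²}(f) := p a_{1,p²}(f) + p^{2k−5}(1 + p²)`, (4.2.16)). [cite: BrumerEtAl2019, (4.2.16)–(4.2.18) p. 1168 and Thm. 4.3.4(iv) p. 1169] -/
def heckePolynomial {R : Type*} [CommRing R] (q k : ℕ) (a b : ℤ) : Polynomial R :=
  X ^ 4 - C (a : R) * X ^ 3 + C (b : R) * X ^ 2 - C ((q : R) ^ (2 * k - 3) * a) * X +
    C ((q : R) ^ (4 * k - 6))

/-- In weight `k = 2` the Hecke polynomial has the shape of the Euler polynomial of an abelian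
surface (`p^{2k−3} = p`, `p^{4k−6} = p²`): the two sides of [BPPTVY, Thm. 7.1.3] are comparable
coefficient by coefficient. [cite: BrumerEtAl2019, (4.1.5) p. 1164 and (4.2.18) p. 1168] -/
theorem heckePolynomial_two {R : Type*} [CommRing R] (q : ℕ) (a b : ℤ) :
    (heckePolynomial q 2 a b : Polynomial R) = eulerPolynomialOfSurface q a b := by
  simp [heckePolynomial, eulerPolynomialOfSurface]

variable {S P : Set (HeightOneSpectrum (𝓞 K))} {J : Matrix (Fin n) (Fin n) ℤ_[ℓ]}
  {ν : absoluteGaloisGroup K → ℤ_[ℓ]} {ρ₁ ρ₂ : FramedGaloisRep K ℤ_[ℓ] n}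

/-- **`paramodular_of_certificate`: certificate ⟹ equality of the prescribed Euler polynomials
at every `v ∉ S`.**  With `K = ℚ`, `ℓ = 2`, `n = 4`, `J` = anti-identity, `ν = χ₂`,
`ρ₁ = ρ_{A,2}` with `D₁.E = L_p(A,·)` ([BPPTVY, (4.1.5)]) and `ρ₂ = ρ_{f,2}` with `D₂.E = Q_p(f,·)`
([BPPTVY, Thm. 4.3.4(iv)]) this is "`L_p(A,T) = Q_p(f,T)` for all `p ∤ 2N`" — the part of [BPPTVY,
Thm. 7.1.3 / 7.2.1 / 7.3.1] ("For all primes `p`, we have `L_p(A_{277},T) = Q_p(f_{277},T)`") that the `2`-adic Faltings–Serre comparison delivers (see the module docstring for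
`p ∣ 2N`).  Kernel-checked from the cited criterion (`hFS`), the tree's Carayol theorem and the
tree's PROVED existence of primes and Frobenius elements above `v`
(`HeightOneSpectrum.primesAbove_nonempty`, `exists_isArithFrobAt_of_mem_primesAbove_holds`).
"Paramodular" itself (existence of the newform `f ∈ S₂(K(N))` of type (G) whose `ρ_{f,2}` carries
`D₂`) is an INPUT here, not a tree notion. [cite: BrumerEtAl2019, Thm. 7.1.3 p. 1187, Thm. 7.2.1 p. 1189, Thm. 7.3.1 p. 1191] -/
theorem paramodular_of_certificate (hFS : traceEq_of_faltingsSerre_symplectic)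
    (C : Certificate S P J ν ρ₁ ρ₂) (D₁ : EulerDatum S ρ₁) (D₂ : EulerDatum S ρ₂) :
    ∀ v ∉ S, D₁.E v = D₂.E v := by
  intro v hv
  obtain ⟨𝔓, h𝔓⟩ := HeightOneSpectrum.primesAbove_nonempty v
  obtain ⟨σ, hσ⟩ := HeightOneSpectrum.exists_isArithFrobAt_of_mem_primesAbove_holds h𝔓
  have h₁ : FramedRep.charpoly ρ₁ σ = D₁.E v := D₁.hasFrobCharpoly v hv 𝔓 h𝔓 σ hσ
  have h₂ : FramedRep.charpoly ρ₁ σ = D₂.E v :=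
    ((C.hasFrobCharpolyAt_iff hFS v (D₂.E v)).2 (D₂.hasFrobCharpoly v hv)) 𝔓 h𝔓 σ hσ
  rw [← h₁, ← h₂]

end Sides

/-! ### E. The numerical schema of the three published certificates (verbatim, pp. 1187–1192) -/

section Data

/-- The three absolutely irreducible residual images allowed by [BPPTVY, Lemma 5.2.1] for a surface of
odd squarefree conductor with a polarization of odd degree: `S₅(b)`, `S₆`, `S₃ ≀ S₂`
(`≤ GSp₄(𝔽₂) ≅ S₆`, Lemma 5.1.7). [cite: BrumerEtAl2019, Lemma 5.1.7 p. 1173 and Lemma 5.2.1 p. 1174] -/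
inductive ResidualImage
  /-- `S₅(b)`, order 120, elements of order 3, 6 have trace 1 (`N = 277`). -/
  | S5b
  /-- `S₆`, order 720 (`N = 587`). -/
  | S6
  /-- `S₃ ≀ S₂`, order 72 (`N = 353`). -/
  | S3wrS2
  deriving DecidableEq, Repr

/-- **The data of a [BPPTVY] certificate** (what the pipeline must produce and what two
independent implementations must reproduce before the `Prop`-fields of `Certificate` are
discharged): the conductor `N` (so `S = {2, N}`), the residual image class, integer polynomials
cutting out `ℚ(A[2])` and the candidate field for `ρ̄_f` (Step 1, Lemma 7.1.4), the core-free
subfield `K₀ = K^H` (Thm. 5.3.1/5.3.3), the number of quadratic extensions `L₀ ⊇ K₀` unramified outside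
`S` (Step 2′c), the number of obstructing pairs considered (Step 3′), the list of check primes `P`
(Step 4), and whether the class-group computations were certified unconditionally (not stated in
[BPPTVY]; recorded as `none`). Polynomials are coefficient lists, constant term first.
[cite: BrumerEtAl2019, §7 pp. 1187–1192] -/
structure CertificateData where
  /-- Conductor `N` of `A` = paramodular level of `f`. -/
  conductor : ℕ
  /-- Residual image class (Lemma 5.2.1). -/
  image : ResidualImage
  /-- A polynomial whose splitting field is `ℚ(A[2])` (coefficients, constant term first). -/
  twoTorsionPoly : List ℤ
  /-- The polynomial selected for the fixed field of `ρ̄_f` in Step 1 (Lemma 7.1.4 and analogues). -/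
  residualFieldPolyF : List ℤ
  /-- Defining polynomial of the core-free subfield `K₀ = K^H`. -/
  coreFreeFieldPoly : List ℤ
  /-- Number of quadratic extensions `L₀ ⊇ K₀` unramified away from `S`. -/
  numQuadraticExtensions : ℕ
  /-- Number of obstructing pairs `(L, φ)` considered (when stated). -/
  numObstructingPairs : Option ℕ
  /-- The check primes `P` of Step 4 (traces compared in Step 5). -/
  checkPrimes : List ℕ
  /-- Whether the class-field-theoretic enumeration was certified without GRH (not stated). -/
  classGroupCertified : Option Bool
  deriving Repr

/-- [BPPTVY, Thm. 7.1.3 and Lemma 7.1.4, §7.1 pp. 1187–1188], `N = 277`, `A = Jac(y² + (x³+x²+x+1)y = −x²−x)`: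
image `S₅(b)`; `ρ̄_A` from `g(x) = 4x⁵ − 8x³ + 8x² − 4x + 1`; `ρ̄_f` matched with
`x⁵ − x⁴ + 2x² − x + 1`; `K₀` of degree `10` given by
`x¹⁰+3x⁹+x⁸−10x⁷−17x⁶−7x⁵+11x⁴+18x³+13x²+5x+1`; `4095` quadratic extensions; `24062` obstructing
pairs; check primes `p ≤ 43`, i.e. `{3,5,7,11,13,17,19,23,29,31,37,41,43}`.
[cite: BrumerEtAl2019, Thm. 7.1.3, Lemma 7.1.4 and proof, pp. 1187–1188] -/
def data277 : CertificateData where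
  conductor := 277
  image := .S5b
  twoTorsionPoly := [1, -4, 8, -8, 0, 4]
  residualFieldPolyF := [1, -1, 2, 0, -1, 1]
  coreFreeFieldPoly := [1, 5, 13, 18, 11, -7, -17, -10, 1, 3, 1]
  numQuadraticExtensions := 4095
  numObstructingPairs := some 24062
  checkPrimes := [3, 5, 7, 11, 13, 17, 19, 23, 29, 31, 37, 41, 43]
  classGroupCertified := none

/-- [BPPTVY, Thm. 7.2.1, §7.2 pp. 1189–1190], `N = 353`, `A = Jac(y² + (x³+x+1)y = x²)`: image `S₃ ≀ S₂`;
`ℚ(A[2])` = splitting field of `x⁶ + 2x⁴ + 2x³ + 5x² + 2x + 1`; `ρ̄_f` matched with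
`x⁶ − 2x⁵ − 3x⁴ + 4x³ + x² − 6x + 1`; `K₀` (core-free subgroup `C₂²`) given by
`x¹⁸ − 10x¹⁴ + 3x¹² + 25x¹⁰ − 5x⁸ − 19x⁶ + 5x² + 1`; `65535` quadratic extensions; check primes
`{3,5,7,11,13,19,23,29,31,37,41,43,53,97,137}` ((7.2.4)). [cite: BrumerEtAl2019, Thm. 7.2.1 and proof, (7.2.3)–(7.2.4), pp. 1189–1190] -/
def data353 : CertificateData where
  conductor := 353
  image := .S3wrS2
  twoTorsionPoly := [1, 2, 5, 2, 2, 0, 1]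
  residualFieldPolyF := [1, -6, 1, 4, -3, -2, 1]
  coreFreeFieldPoly := [1, 0, 5, 0, 0, 0, -19, 0, -5, 0, 25, 0, 3, 0, -10, 0, 0, 0, 1]
  numQuadraticExtensions := 65535
  numObstructingPairs := none
  checkPrimes := [3, 5, 7, 11, 13, 19, 23, 29, 31, 37, 41, 43, 53, 97, 137]
  classGroupCertified := none

/-- [BPPTVY, Thm. 7.3.1, §7.3 pp. 1191–1192], `N = 587`, `A = Jac(y² + (x³+x+1)y = −x²−x)`: image `S₆`;
`ℚ(A[2])` = splitting field of `x⁶ − 2x⁵ + 2x⁴ − x² + 2x − 1` (also the field of `ρ̄_f`); `K₀` of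
degree `20` given by `x²⁰ + x¹⁸ − 4x¹⁷ − 3x¹⁶ − 2x¹⁵ + 7x¹⁴ − 6x¹³ − 18x¹² − 8x¹¹ + 8x¹⁰ + 8x⁹ − 18x⁸
+ 6x⁷ + 7x⁶ + 2x⁵ − 3x⁴ + 4x³ + x² + 1`; `2¹⁹ − 1 = 524287` quadratic extensions; check primes
`{3,5,7,11,13,17,19,23,29,37,41}` ((7.3.3)). [cite: BrumerEtAl2019, Thm. 7.3.1 and proof, (7.3.2)–(7.3.3), pp. 1191–1192] -/
def data587 : CertificateData where
  conductor := 587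
  image := .S6
  twoTorsionPoly := [-1, 2, -1, 0, 2, -2, 1]
  residualFieldPolyF := [-1, 2, -1, 0, 2, -2, 1]
  coreFreeFieldPoly := [1, 0, 1, 4, -3, 2, 7, 6, -18, 8, 8, -8, -18, -6, 7, -2, -3, -4, 1, 0, 1]
  numQuadraticExtensions := 524287
  numObstructingPairs := none
  checkPrimes := [3, 5, 7, 11, 13, 17, 19, 23, 29, 37, 41]
  classGroupCertified := none

/-- Sanity (kernel `decide`): the numbers of quadratic extensions are `2^d − 1` with
`d = 12, 16, 19` (the `𝔽₂`-rank of the relevant ray class / Selmer-type group), as printed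
("`2¹⁹ − 1 = 524287`"). [cite: BrumerEtAl2019, §7.3 p. 1191] -/
theorem numQuadraticExtensions_eq :
    data277.numQuadraticExtensions = 2 ^ 12 - 1 ∧ data353.numQuadraticExtensions = 2 ^ 16 - 1 ∧
      data587.numQuadraticExtensions = 2 ^ 19 - 1 := by
  decide

/-- Sanity: the coefficient lists of `K₀` have the printed degrees `10` (`[S₅(b) : D₆(b)]`,
[BPPTVY, §7.1 p. 1188]), `18` (`[S₃ ≀ S₂ : C₂²]`, (7.2.3) p. 1190) and `20` ((7.3.2) p. 1191). [cite: BrumerEtAl2019, §7 pp. 1188–1191] -/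
theorem coreFreeFieldPoly_degree :
    data277.coreFreeFieldPoly.length = 10 + 1 ∧ data353.coreFreeFieldPoly.length = 18 + 1 ∧
      data587.coreFreeFieldPoly.length = 20 + 1 := by
  decide

end Data

end Literature.NumberTheory.FaltingsSerre
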